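import Mathlib
import HarnessLib
import Summits.Ventures.LatticeQCDFlow.Scoring.BatchMeansFixedBatchCount
import Summits.Ventures.LatticeQCDFlow.Scoring.IndependentJointLimitVector

/-!
# THE TWO-CHAIN A-vs-B MEAN TEST AT A FIXED NUMBER OF BATCHES PER ARM: from any starts,
# `P(|B̄^A − B̄^B| ≤ z √(SE²_A + SE²_B)) → P(a (Ḡ₁ − Ḡ₂)² ≤ z² (s²(G₁) + s²(G₂)))` — Student `t_{2a−2}`

HONEST FRAMING: exact (Metropolis-corrected) sampling algorithms for lattice gauge theory;
figures of merit are autocorrelation/cost numbers at stated couplings and volumes; no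
continuum-physics claim.

Venture `LatticeQCDFlow` (cell pub-lqcd), topic `Scoring`; FANOUT row 4 (`s0-u1-b`, GEN-32).
NEW WORK of the cell, not a published result; no definition is introduced; nothing is cited as a
fact.  Row 4's acceptance sentence is "A vs B within `z σ_comb`": two INDEPENDENT runs of one exact
sampler, each summarised by its run mean and a batch-means standard error.  The tree calibrates it
when the number of batches grows (`Scoring/AsymptoticCoverage.lean`, `Scoring/DoeblinPowerTwoChainAgreement*`:
the statistic is asymptotically `N(0,1)`).  With a FIXED number `a ≥ 2` of batches per arm (equal
batch lengths `b_n → ∞` in both arms) the error bars do not converge to constants and the limit is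
NOT normal: by the joint CLT of the batch means (`Scoring/BatchMeansJointCLT.lean`) in each arm, the
joint limit of the two independent arms (`Scoring/IndependentJointLimitVector.lean`), the continuous
mapping theorem for `(v, w) ↦ a (v̄ − w̄)² − z² (s²(v) + s²(w))` and the portmanteau theorem — whose
null-boundary input is the two-sample Student boundary lemma of
`Scoring/GaussianStudentBoundary.lean` — for every kernel with a geometric sup-norm envelope, every
bounded observable with `σ²_f > 0`, ANY two initial laws and every `z ≥ 0`:
`(P_A ⊗ P_B)(|B̄^A_n − B̄^B_n| ≤ z √(SE²_{A,n} + SE²_{B,n})) → (N(0,1)^{⊗a} ⊗ N(0,1)^{⊗a}){a (ḡ − h̄)² ≤ z² (s²(g) + s²(h))}`,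
the two-sided Student-`t_{2a−2}` probability of `[−z, z]` (`T = √a (Ḡ₁ − Ḡ₂)/√(s²(G₁) + s²(G₂))` has
`2a − 2` degrees of freedom; named, not evaluated).  READING: with `a` bins per arm the nominal
one-sigma pass rate of two correct codes is `P(|t_{2a−2}| ≤ 1)`, not `0.683`.  Printed counterpart
NAMED ONLY: the two-sample `t` statistic with pooled batch means (Schmeiser 1982; Law–Kelton 2000
§10.2), nothing cited as a fact.

## Content (`π` invariant, envelope `(A, ρ)`; `|f| ≤ C` measurable, `σ²_f > 0`; `a = k+1 ≥ 2`;
## `P_A = P_{μ_A}`, `P_B = P_{μ_B}` path laws from ANY starts; `G₁ ⟂ G₂ ∼ N(0,1)^{⊗a}`)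

* `batchMeans_scaledMean_eq` — `(Σ_j V_j)/a = √b (B̄ − c)`;
* `batchMeans_twoSample_coverage_iff_student` — the event identity;
* `continuous_euclidean_twoSample_student` — continuity of the two-sample Student functional;
* **`chain_batchMeans_twoChain_fixedBatches_coverage_of_envelope`** — the theorem above.

NOT CLAIMED: unequal batch lengths / numbers of batches in the two arms (a Behrens–Fisher-type
limit); the value of the Student probability; Doeblin-power restatement (immediate); any number of ours.
-/

noncomputable section

namespace Summit.Ventures.LatticeQCDFlow.Scoring

open MeasureTheory ProbabilityTheory Filter Finset Preorder
open scoped ENNReal Topology RealInnerProductSpace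

variable {Ω : Type*} [MeasurableSpace Ω]

/-! ### Algebra -/

section Algebra

/-- The mean of the scaled centred batch sums is `√b` times the centred run mean:
`(Σ_{j<a} V_j)/a = √b (B̄ − c)` (`b ≥ 1`, `a ≥ 1`). -/
theorem batchMeans_scaledMean_eq (y : ℕ → ℝ) (c : ℝ) {a b : ℕ} (ha : 0 < a) (hb : 0 < b) :
    (∑ i ∈ Finset.range a, (∑ r ∈ Finset.range b, (y (b * i + r) - c)) / Real.sqrt b) / (a : ℝ)
      = Real.sqrt b * (replicaMean (fun j (_ : Unit) => (∑ i ∈ Finset.range b, y (b * j + i)) / b) a () - c) := by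
  have hbR : (0 : ℝ) < b := Nat.cast_pos.2 hb
  have hsb : 0 < Real.sqrt b := Real.sqrt_pos.2 hbR
  have haR : (0 : ℝ) < a := Nat.cast_pos.2 ha
  have hV : ∀ j, (∑ r ∈ Finset.range b, (y (b * j + r) - c)) / Real.sqrt b
      = Real.sqrt b * ((∑ i ∈ Finset.range b, y (b * j + i)) / b - c) := by
    intro j
    have hsq : Real.sqrt (b : ℝ) * Real.sqrt b = b := Real.mul_self_sqrt hbR.le
    rw [div_eq_iff hsb.ne', Finset.sum_sub_distrib, Finset.sum_const, Finset.card_range, nsmul_eq_mul]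
    have : Real.sqrt (b : ℝ) * ((∑ i ∈ Finset.range b, y (b * j + i)) / b - c) * Real.sqrt b
        = (Real.sqrt (b : ℝ) * Real.sqrt b) * ((∑ i ∈ Finset.range b, y (b * j + i)) / b - c) := by ring
    rw [this, hsq]
    field_simp
  simp_rw [hV]
  unfold replicaMean
  rw [← Finset.mul_sum, Finset.sum_sub_distrib, Finset.sum_const, Finset.card_range, nsmul_eq_mul]
  field_simp

/-- **The two-chain fixed-`a` coverage event is the two-sample Student event of the scaled
batch-sum vectors**: `b ≥ 1`, `a ≥ 2`, `z ≥ 0`: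
`|B̄^A − B̄^B| ≤ z √(SE²_A + SE²_B) ↔ a (V̄^A − V̄^B)² − z² (s²(V^A) + s²(V^B)) ≤ 0`. -/
theorem batchMeans_twoSample_coverage_iff_student (yA yB : ℕ → ℝ) (c : ℝ) {a b : ℕ} (ha : 2 ≤ a)
    (hb : 0 < b) {z : ℝ} (hz : 0 ≤ z) :
    |replicaMean (fun j (_ : Unit) => (∑ i ∈ Finset.range b, yA (b * j + i)) / b) a ()
        - replicaMean (fun j (_ : Unit) => (∑ i ∈ Finset.range b, yB (b * j + i)) / b) a ()|
        ≤ z * Real.sqrt (replicaSEsq (fun j (_ : Unit) => (∑ i ∈ Finset.range b, yA (b * j + i)) / b) a ()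
          + replicaSEsq (fun j (_ : Unit) => (∑ i ∈ Finset.range b, yB (b * j + i)) / b) a ())
      ↔ (a : ℝ) * ((∑ i ∈ Finset.range a, (∑ r ∈ Finset.range b, (yA (b * i + r) - c)) / Real.sqrt b) / (a : ℝ)
            - (∑ i ∈ Finset.range a, (∑ r ∈ Finset.range b, (yB (b * i + r) - c)) / Real.sqrt b) / (a : ℝ)) ^ 2
          - z ^ 2 * (((∑ j ∈ Finset.range a, ((∑ r ∈ Finset.range b, (yA (b * j + r) - c)) / Real.sqrt b
              - (∑ i ∈ Finset.range a, (∑ r ∈ Finset.range b, (yA (b * i + r) - c)) / Real.sqrt b) / (a : ℝ)) ^ 2)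
              / ((a : ℝ) - 1))
            + ((∑ j ∈ Finset.range a, ((∑ r ∈ Finset.range b, (yB (b * j + r) - c)) / Real.sqrt b
              - (∑ i ∈ Finset.range a, (∑ r ∈ Finset.range b, (yB (b * i + r) - c)) / Real.sqrt b) / (a : ℝ)) ^ 2)
              / ((a : ℝ) - 1))) ≤ 0 := by
  have hbR : (0 : ℝ) < b := Nat.cast_pos.2 hb
  have haR : (2 : ℝ) ≤ a := by exact_mod_cast ha
  have ha0 : (0 : ℝ) < (a : ℝ) := by linarith
  have hsvA := batchMeans_sigmaHat_eq_svar yA c (a := a) hb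
  have hsvB := batchMeans_sigmaHat_eq_svar yB c (a := a) hb
  have hmA := batchMeans_scaledMean_eq yA c (a := a) (by omega) hb
  have hmB := batchMeans_scaledMean_eq yB c (a := a) (by omega) hb
  set SEA := replicaSEsq (fun j (_ : Unit) => (∑ i ∈ Finset.range b, yA (b * j + i)) / b) a () with hSEA
  set SEB := replicaSEsq (fun j (_ : Unit) => (∑ i ∈ Finset.range b, yB (b * j + i)) / b) a () with hSEB
  set MA := replicaMean (fun j (_ : Unit) => (∑ i ∈ Finset.range b, yA (b * j + i)) / b) a () with hMA
  set MB := replicaMean (fun j (_ : Unit) => (∑ i ∈ Finset.range b, yB (b * j + i)) / b) a () with hMB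
  have hden : (0 : ℝ) ≤ (a : ℝ) * ((a : ℝ) - 1) := mul_nonneg ha0.le (by linarith)
  have hSEnn : 0 ≤ SEA + SEB := by
    simp only [hSEA, hSEB, replicaSEsq]
    exact add_nonneg (div_nonneg (Finset.sum_nonneg fun j _ => sq_nonneg _) hden)
      (div_nonneg (Finset.sum_nonneg fun j _ => sq_nonneg _) hden)
  rw [← hsvA, ← hsvB, hmA, hmB]
  have hv0 : 0 ≤ z * Real.sqrt (SEA + SEB) := mul_nonneg hz (Real.sqrt_nonneg _)
  have key : |MA - MB| ≤ z * Real.sqrt (SEA + SEB) ↔ (MA - MB) ^ 2 ≤ (z * Real.sqrt (SEA + SEB)) ^ 2 := by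
    constructor
    · intro h
      have := pow_le_pow_left₀ (abs_nonneg _) h 2
      rwa [sq_abs] at this
    · intro h
      exact abs_le_of_sq_le_sq h hv0
  rw [key, mul_pow, Real.sq_sqrt hSEnn, Nat.cast_mul]
  have hab : (0 : ℝ) < a * b := mul_pos ha0 hbR
  have hsq' : (a : ℝ) * (Real.sqrt b * (MA - c) - Real.sqrt b * (MB - c)) ^ 2 = (a : ℝ) * b * (MA - MB) ^ 2 := by
    rw [← mul_sub, mul_pow, Real.sq_sqrt hbR.le]; ring
  rw [hsq']
  constructor
  · intro h
    have h2 := mul_le_mul_of_nonneg_left h hab.le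
    linarith [h2]
  · intro h
    by_contra hlt
    push Not at hlt
    have h2 := mul_lt_mul_of_pos_left hlt hab
    linarith [h2]

/-- The two-sample Student functional on `EuclideanSpace ℝ (Fin a) × EuclideanSpace ℝ (Fin a)` is
continuous. -/
theorem continuous_euclidean_twoSample_student (a : ℕ) (z : ℝ) :
    Continuous fun p : EuclideanSpace ℝ (Fin a) × EuclideanSpace ℝ (Fin a) =>
      (a : ℝ) * ((∑ i, p.1 i) / (a : ℝ) - (∑ i, p.2 i) / (a : ℝ)) ^ 2
        - z ^ 2 * (((∑ j, (p.1 j - (∑ i, p.1 i) / (a : ℝ)) ^ 2) / ((a : ℝ) - 1))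
          + ((∑ j, (p.2 j - (∑ i, p.2 i) / (a : ℝ)) ^ 2) / ((a : ℝ) - 1))) := by
  have h1 : ∀ j : Fin a, Continuous fun p : EuclideanSpace ℝ (Fin a) × EuclideanSpace ℝ (Fin a) => p.1 j :=
    fun j => (continuous_euclideanSpace_coord j).comp continuous_fst
  have h2 : ∀ j : Fin a, Continuous fun p : EuclideanSpace ℝ (Fin a) × EuclideanSpace ℝ (Fin a) => p.2 j :=
    fun j => (continuous_euclideanSpace_coord j).comp continuous_snd
  fun_prop

end Algebra

/-! ### The theorem -/

section Envelope

variable {κ : Kernel Ω Ω} [IsMarkovKernel κ] {π : Measure Ω} [IsProbabilityMeasure π] {A ρ : ℝ}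

/-- **THE TWO-CHAIN ONE-SIGMA RULE AT A FIXED NUMBER OF BATCHES IS STUDENT, NOT NORMAL.**
`π` invariant, envelope `(A, ρ)`, `|f| ≤ C` measurable with `σ²_f > 0`; `a ≥ 2` batches of length
`b_n → ∞` in each of two INDEPENDENT runs from ANY starts `μ_A`, `μ_B`; `z ≥ 0`; `G₁ ⟂ G₂` two
vectors of `a` independent standard Gaussians.  Then
`(P_A ⊗ P_B)(|B̄^A_n − B̄^B_n| ≤ z √(SE²_{A,n} + SE²_{B,n})) → (N(0,1)^{⊗a} ⊗ N(0,1)^{⊗a}){a (ḡ − h̄)² ≤ z² (s²(g) + s²(h))}`. -/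
theorem chain_batchMeans_twoChain_fixedBatches_coverage_of_envelope (hπ : Kernel.Invariant κ π)
    (henv : ∀ (g : Ω → ℝ), Measurable g → ∀ (Cg : ℝ), (∀ x, |g x| ≤ Cg) →
      ∀ (t : ℕ) (x : Ω), |(kop κ)^[t] g x - ∫ y, g y ∂π| ≤ 2 * Cg * (A * ρ ^ t))
    (hA : 0 ≤ A) (hρ0 : 0 ≤ ρ) (hρ1 : ρ < 1)
    {f : Ω → ℝ} (hf : Measurable f) {C : ℝ} (hC : ∀ x, |f x| ≤ C)
    (hσ : 0 < ((∫ y, (f y - ∫ z, f z ∂(π)) ^ 2 ∂(π)) + 2 * ∑' k, ∫ y, (f y - ∫ z, f z ∂(π)) * (kop (κ))^[k + 1] (fun y => f y - ∫ z, f z ∂(π)) y ∂(π)))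
    (μA μB : Measure Ω) [IsProbabilityMeasure μA] [IsProbabilityMeasure μB] {a : ℕ} (ha : 2 ≤ a)
    {b : ℕ → ℕ} (hb : Tendsto b atTop atTop) {z : ℝ} (hz : 0 ≤ z)
    {Ω' : Type*} [MeasurableSpace Ω'] {P' : Measure Ω'} [IsProbabilityMeasure P']
    {G₁ G₂ : Ω' → (Fin a → ℝ)} (hG₁ : HasLaw G₁ (Measure.pi fun _ : Fin a => gaussianReal 0 1) P')
    (hG₂ : HasLaw G₂ (Measure.pi fun _ : Fin a => gaussianReal 0 1) P') (hind : IndepFun G₁ G₂ P')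
    [IsProbabilityMeasure (Kernel.trajMeasure (X := fun _ : ℕ => Ω) (μA)
          (fun n : ℕ => κ.comap (fun h' : (i : ↥(Finset.Iic n)) → Ω => h' ⟨n, Finset.mem_Iic.2 le_rfl⟩)
            (measurable_pi_apply _)))]
    [IsProbabilityMeasure (Kernel.trajMeasure (X := fun _ : ℕ => Ω) (μB)
          (fun n : ℕ => κ.comap (fun h' : (i : ↥(Finset.Iic n)) → Ω => h' ⟨n, Finset.mem_Iic.2 le_rfl⟩)
            (measurable_pi_apply _)))] :
    Tendsto (fun n => ((Kernel.trajMeasure (X := fun _ : ℕ => Ω) (μA)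
            (fun n : ℕ => κ.comap (fun h' : (i : ↥(Finset.Iic n)) → Ω => h' ⟨n, Finset.mem_Iic.2 le_rfl⟩)
              (measurable_pi_apply _))).prod
          (Kernel.trajMeasure (X := fun _ : ℕ => Ω) (μB)
            (fun n : ℕ => κ.comap (fun h' : (i : ↥(Finset.Iic n)) → Ω => h' ⟨n, Finset.mem_Iic.2 le_rfl⟩)
              (measurable_pi_apply _)))).real
        {ω : (ℕ → Ω) × (ℕ → Ω) |
          |replicaMean (fun j (x : ℕ → Ω) => (∑ i ∈ Finset.range (b n), f (x (b n * j + i))) / (b n)) a ω.1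
            - replicaMean (fun j (x : ℕ → Ω) => (∑ i ∈ Finset.range (b n), f (x (b n * j + i))) / (b n)) a ω.2|
          ≤ z * Real.sqrt (replicaSEsq (fun j (x : ℕ → Ω) => (∑ i ∈ Finset.range (b n), f (x (b n * j + i))) / (b n)) a ω.1
              + replicaSEsq (fun j (x : ℕ → Ω) => (∑ i ∈ Finset.range (b n), f (x (b n * j + i))) / (b n)) a ω.2)})
      atTop (𝓝 (((Measure.pi fun _ : Fin a => gaussianReal 0 1).prod (Measure.pi fun _ : Fin a => gaussianReal 0 1)).real
        {p : (Fin a → ℝ) × (Fin a → ℝ) | (a : ℝ) * ((∑ i, p.1 i) / (a : ℝ) - (∑ i, p.2 i) / (a : ℝ)) ^ 2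
            ≤ z ^ 2 * (((∑ j, (p.1 j - (∑ i, p.1 i) / (a : ℝ)) ^ 2) / ((a : ℝ) - 1))
              + ((∑ j, (p.2 j - (∑ i, p.2 i) / (a : ℝ)) ^ 2) / ((a : ℝ) - 1)))})) := by
  obtain ⟨k, rfl⟩ := Nat.exists_eq_succ_of_ne_zero (show a ≠ 0 by omega)
  have hk : 1 ≤ k := by omega
  set PA := (Kernel.trajMeasure (X := fun _ : ℕ => Ω) (μA)
        (fun n : ℕ => κ.comap (fun h' : (i : ↥(Finset.Iic n)) → Ω => h' ⟨n, Finset.mem_Iic.2 le_rfl⟩)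
          (measurable_pi_apply _))) with hPA
  set PB := (Kernel.trajMeasure (X := fun _ : ℕ => Ω) (μB)
        (fun n : ℕ => κ.comap (fun h' : (i : ↥(Finset.Iic n)) → Ω => h' ⟨n, Finset.mem_Iic.2 le_rfl⟩)
          (measurable_pi_apply _))) with hPB
  set σ2 : ℝ := ((∫ y, (f y - ∫ z, f z ∂(π)) ^ 2 ∂(π)) + 2 * ∑' k, ∫ y, (f y - ∫ z, f z ∂(π)) * (kop (κ))^[k + 1] (fun y => f y - ∫ z, f z ∂(π)) y ∂(π)) with hσ2
  have hσ2nn : 0 ≤ σ2 := hσ.le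
  -- the two joint CLTs and their joint (independent) limit
  have hZ₁ := hasLaw_toLp_of_hasLaw_pi_gaussianReal hG₁
  have hZ₂ := hasLaw_toLp_of_hasLaw_pi_gaussianReal hG₂
  have hJA := chain_batchMeans_joint_clt_of_envelope hπ henv hA hρ0 hρ1 hf hC μA (k + 1) hb hZ₁
  have hJB := chain_batchMeans_joint_clt_of_envelope hπ henv hA hρ0 hρ1 hf hC μB (k + 1) hb hZ₂
  have hmeas : Measurable fun g : Fin (k + 1) → ℝ =>
      Real.sqrt σ2 • (WithLp.toLp 2 g : EuclideanSpace ℝ (Fin (k + 1))) :=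
    (measurable_const_smul _).comp (WithLp.measurable_toLp 2 _)
  have hindL : IndepFun (fun ω => Real.sqrt σ2 • (WithLp.toLp 2 (G₁ ω) : EuclideanSpace ℝ (Fin (k + 1))))
      (fun ω => Real.sqrt σ2 • (WithLp.toLp 2 (G₂ ω) : EuclideanSpace ℝ (Fin (k + 1)))) P' :=
    hind.comp hmeas hmeas
  have hpair := CardConsistency.tendstoInDistribution_prodMk_twoCodes_vector hJA hJB hindL
  -- the two-sample Student functional and its limit `σ² · H₀(G₁, G₂)`
  have hcont := hpair.continuous_comp (continuous_euclidean_twoSample_student (k + 1) z)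
  set H₀ : (Fin (k + 1) → ℝ) × (Fin (k + 1) → ℝ) → ℝ := fun p =>
    ((k + 1 : ℕ) : ℝ) * ((∑ i, p.1 i) / ((k + 1 : ℕ) : ℝ) - (∑ i, p.2 i) / ((k + 1 : ℕ) : ℝ)) ^ 2
      - z ^ 2 * (((∑ j, (p.1 j - (∑ i, p.1 i) / ((k + 1 : ℕ) : ℝ)) ^ 2) / (((k + 1 : ℕ) : ℝ) - 1))
        + ((∑ j, (p.2 j - (∑ i, p.2 i) / ((k + 1 : ℕ) : ℝ)) ^ 2) / (((k + 1 : ℕ) : ℝ) - 1))) with hH₀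
  have hH₀m : Measurable H₀ := by
    simp only [hH₀]
    fun_prop
  have hlim : ∀ ω, ((fun p : EuclideanSpace ℝ (Fin (k + 1)) × EuclideanSpace ℝ (Fin (k + 1)) =>
      ((k + 1 : ℕ) : ℝ) * ((∑ i, p.1 i) / ((k + 1 : ℕ) : ℝ) - (∑ i, p.2 i) / ((k + 1 : ℕ) : ℝ)) ^ 2
        - z ^ 2 * (((∑ j, (p.1 j - (∑ i, p.1 i) / ((k + 1 : ℕ) : ℝ)) ^ 2) / (((k + 1 : ℕ) : ℝ) - 1))
          + ((∑ j, (p.2 j - (∑ i, p.2 i) / ((k + 1 : ℕ) : ℝ)) ^ 2) / (((k + 1 : ℕ) : ℝ) - 1)))) ∘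
      (fun ω => (Real.sqrt σ2 • (WithLp.toLp 2 (G₁ ω) : EuclideanSpace ℝ (Fin (k + 1))),
        Real.sqrt σ2 • (WithLp.toLp 2 (G₂ ω) : EuclideanSpace ℝ (Fin (k + 1)))))) ω
      = σ2 * H₀ (G₁ ω, G₂ ω) := by
    intro ω
    simp only [Function.comp, PiLp.smul_apply, smul_eq_mul, hH₀]
    have e1 : ∀ (g : Fin (k + 1) → ℝ), ∑ i, Real.sqrt σ2 * g i = Real.sqrt σ2 * ∑ i, g i :=
      fun g => by rw [Finset.mul_sum]
    have e2 : ∀ (g : Fin (k + 1) → ℝ) (j : Fin (k + 1)),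
        Real.sqrt σ2 * g j - Real.sqrt σ2 * (∑ i, g i) / ((k + 1 : ℕ) : ℝ)
          = Real.sqrt σ2 * (g j - (∑ i, g i) / ((k + 1 : ℕ) : ℝ)) := fun g j => by ring
    have e3 : ∀ (g : Fin (k + 1) → ℝ), (Real.sqrt σ2 * ∑ i, g i) / ((k + 1 : ℕ) : ℝ)
        = Real.sqrt σ2 * ((∑ i, g i) / ((k + 1 : ℕ) : ℝ)) := fun g => by ring
    show ((k + 1 : ℕ) : ℝ) * ((∑ i, Real.sqrt σ2 * G₁ ω i) / ((k + 1 : ℕ) : ℝ) - (∑ i, Real.sqrt σ2 * G₂ ω i) / ((k + 1 : ℕ) : ℝ)) ^ 2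
        - z ^ 2 * (((∑ j, (Real.sqrt σ2 * G₁ ω j - (∑ i, Real.sqrt σ2 * G₁ ω i) / ((k + 1 : ℕ) : ℝ)) ^ 2) / (((k + 1 : ℕ) : ℝ) - 1))
          + ((∑ j, (Real.sqrt σ2 * G₂ ω j - (∑ i, Real.sqrt σ2 * G₂ ω i) / ((k + 1 : ℕ) : ℝ)) ^ 2) / (((k + 1 : ℕ) : ℝ) - 1)))
      = σ2 * (((k + 1 : ℕ) : ℝ) * ((∑ i, G₁ ω i) / ((k + 1 : ℕ) : ℝ) - (∑ i, G₂ ω i) / ((k + 1 : ℕ) : ℝ)) ^ 2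
        - z ^ 2 * (((∑ j, (G₁ ω j - (∑ i, G₁ ω i) / ((k + 1 : ℕ) : ℝ)) ^ 2) / (((k + 1 : ℕ) : ℝ) - 1))
          + ((∑ j, (G₂ ω j - (∑ i, G₂ ω i) / ((k + 1 : ℕ) : ℝ)) ^ 2) / (((k + 1 : ℕ) : ℝ) - 1))))
    rw [e1, e1]
    simp_rw [e2, mul_pow, Real.sq_sqrt hσ2nn, ← Finset.mul_sum, e3]
    rw [← mul_sub, mul_pow, Real.sq_sqrt hσ2nn]
    ring
  have hclt := hcont.congr (fun n => ae_of_all _ fun x => rfl) (ae_of_all _ hlim)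
  -- the law of the pair `(G₁, G₂)` is the product Gaussian law
  have hpairlaw : P'.map (fun ω => (G₁ ω, G₂ ω))
      = (Measure.pi fun _ : Fin (k + 1) => gaussianReal 0 1).prod (Measure.pi fun _ : Fin (k + 1) => gaussianReal 0 1) := by
    rw [(indepFun_iff_map_prod_eq_prod_map_map hG₁.aemeasurable hG₂.aemeasurable).1 hind, hG₁.map_eq, hG₂.map_eq]
  have hGpm : AEMeasurable (fun ω => (G₁ ω, G₂ ω)) P' := hG₁.aemeasurable.prodMk hG₂.aemeasurable
  -- portmanteau on `(−∞, 0]`, null frontier by the two-sample Student boundary lemma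
  have hZm : AEMeasurable (fun ω => σ2 * H₀ (G₁ ω, G₂ ω)) P' :=
    (hH₀m.comp_aemeasurable hGpm).const_mul σ2
  have hfr : (P'.map (fun ω => σ2 * H₀ (G₁ ω, G₂ ω))) (frontier (Set.Iic (0 : ℝ))) = 0 := by
    rw [frontier_Iic, Measure.map_apply_of_aemeasurable hZm (measurableSet_singleton 0)]
    have hset : (fun ω => σ2 * H₀ (G₁ ω, G₂ ω)) ⁻¹' {0} = (fun ω => (G₁ ω, G₂ ω)) ⁻¹' {p | H₀ p = 0} := by
      ext ω
      simp only [Set.mem_preimage, Set.mem_singleton_iff, Set.mem_setOf_eq, mul_eq_zero, hσ.ne', false_or]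
    have hE0 : MeasurableSet {p : (Fin (k + 1) → ℝ) × (Fin (k + 1) → ℝ) | H₀ p = 0} :=
      hH₀m (measurableSet_singleton 0)
    rw [hset, ← Measure.map_apply_of_aemeasurable hGpm hE0, hpairlaw]
    exact pi_gaussianReal_twoSample_studentBoundary_eq_zero k hk z
  have key := CardConsistency.tendsto_measureReal_preimage_of_tendstoInDistribution hclt measurableSet_Iic hfr
  -- identify the limiting probability
  have hlimset : P'.real ((fun ω => σ2 * H₀ (G₁ ω, G₂ ω)) ⁻¹' Set.Iic 0)
      = ((Measure.pi fun _ : Fin (k + 1) => gaussianReal 0 1).prod (Measure.pi fun _ : Fin (k + 1) => gaussianReal 0 1)).real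
        {p : (Fin (k + 1) → ℝ) × (Fin (k + 1) → ℝ) |
          ((k + 1 : ℕ) : ℝ) * ((∑ i, p.1 i) / ((k + 1 : ℕ) : ℝ) - (∑ i, p.2 i) / ((k + 1 : ℕ) : ℝ)) ^ 2
            ≤ z ^ 2 * (((∑ j, (p.1 j - (∑ i, p.1 i) / ((k + 1 : ℕ) : ℝ)) ^ 2) / (((k + 1 : ℕ) : ℝ) - 1))
              + ((∑ j, (p.2 j - (∑ i, p.2 i) / ((k + 1 : ℕ) : ℝ)) ^ 2) / (((k + 1 : ℕ) : ℝ) - 1)))} := by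
    have hset : (fun ω => σ2 * H₀ (G₁ ω, G₂ ω)) ⁻¹' Set.Iic 0 = (fun ω => (G₁ ω, G₂ ω)) ⁻¹' {p | H₀ p ≤ 0} := by
      ext ω
      simp only [Set.mem_preimage, Set.mem_Iic, Set.mem_setOf_eq]
      constructor
      · intro h; nlinarith [hσ]
      · intro h; nlinarith [hσ]
    have hE : MeasurableSet {p : (Fin (k + 1) → ℝ) × (Fin (k + 1) → ℝ) | H₀ p ≤ 0} := hH₀m measurableSet_Iic
    rw [hset, measureReal_def, measureReal_def, ← Measure.map_apply_of_aemeasurable hGpm hE, hpairlaw]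
    congr 1
    congr 1
    ext p
    simp only [Set.mem_setOf_eq, hH₀, sub_nonpos]
  rw [hlimset] at key
  refine key.congr' ?_
  filter_upwards [hb.eventually_gt_atTop 0] with n hn
  congr 1
  ext ω
  simp only [Set.mem_preimage, Set.mem_Iic, Set.mem_setOf_eq, Function.comp]
  rw [Fin.sum_univ_eq_sum_range (fun i => (∑ r ∈ Finset.range (b n), (f (ω.1 (b n * i + r)) - ∫ z, f z ∂π)) / Real.sqrt (b n)) (k + 1),
    Fin.sum_univ_eq_sum_range (fun i => (∑ r ∈ Finset.range (b n), (f (ω.2 (b n * i + r)) - ∫ z, f z ∂π)) / Real.sqrt (b n)) (k + 1),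
    Fin.sum_univ_eq_sum_range (fun j => ((∑ r ∈ Finset.range (b n), (f (ω.1 (b n * j + r)) - ∫ z, f z ∂π)) / Real.sqrt (b n)
      - (∑ i ∈ Finset.range (k + 1), (∑ r ∈ Finset.range (b n), (f (ω.1 (b n * i + r)) - ∫ z, f z ∂π)) / Real.sqrt (b n)) / ((k + 1 : ℕ) : ℝ)) ^ 2) (k + 1),
    Fin.sum_univ_eq_sum_range (fun j => ((∑ r ∈ Finset.range (b n), (f (ω.2 (b n * j + r)) - ∫ z, f z ∂π)) / Real.sqrt (b n)
      - (∑ i ∈ Finset.range (k + 1), (∑ r ∈ Finset.range (b n), (f (ω.2 (b n * i + r)) - ∫ z, f z ∂π)) / Real.sqrt (b n)) / ((k + 1 : ℕ) : ℝ)) ^ 2) (k + 1)]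
  exact (batchMeans_twoSample_coverage_iff_student (fun t => f (ω.1 t)) (fun t => f (ω.2 t)) (∫ z, f z ∂π) ha hn hz).symm

end Envelope

end Summit.Ventures.LatticeQCDFlow.Scoring

end
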